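import Mathlib
import Summits.NavierStokesRegularity.NavierStokesRegularity.Theorems.EulerZoomLiouvillePowerGaugeEulerLiouvilleSelfSimilarIrrotationalGrowth
import Summits.NavierStokesRegularity.NavierStokesRegularity.Theorems.EulerZoomLiouvillePowerGaugeEulerLiouvilleSelfSimilarVorticity
import Literature.Analysis.FluidPDE.SelfSimilarEulerVorticityCompactSupport
import HarnessLib

/-!
# Rung C1 of the crux `EulerZoomLiouville.PowerGaugeEulerLiouville`: exactly self-similar members (about ANY blow-up point) whose
# `C²` velocity profile has COMPACTLY SUPPORTED VORTICITY are trivial — no growth, pressure or far-field hypothesis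
# (crux E = stmt-NavierStokesRegularity-19832, line `birth`, rung C1)

Route №10 `EulerZoomLiouville` (NavierStokesRegularity).  Interim LEAD ns-typeII-p2 g9.  The tree's
`selfSimilar_ae_eq_zero_of_hasCompactSupport_curl` (`…SelfSimilarVorticity`, Chae–Shvydkoy 2013 Thm 4.1's endgame) kills an exactly
self-similar member whose CLASSICAL profile `(V, P)` (CIV (3.3), `IsSelfSimilarEulerProfile`) has compactly supported vorticity: the
Eulerian `p → 0` identity gives `curl V ≡ 0` (`IsSelfSimilarEulerProfile.curl_eq_zero_of_hasCompactSupport`) and the `A`-gauge's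
growth kills the irrotational incompressible profile.  This file restates it in the binder shape of the skeleton's strata — the
hypothesis is on the VELOCITY profile only (`V ∈ C²`, `curl V` compactly supported), CIV (3.3) for some `C¹` pressure being
DERIVED from the member (`WeakToClassical.exists_isSelfSimilarEulerProfile_of_contDiff`) — and transports it to members exactly
self-similar about any `(T, x₀)`, `T ≥ 0` (`Shifted.isDistributional_selfSimilarCollapse_of_shifted`,
`Shifted.selfSimilar_ae_eq_zero_of_irrotationalC2_profile`).

* `Loc.selfSimilar_ae_eq_zero_of_compactCurlC2_profile` — crux hypotheses verbatim (`0 < ρ < 1`) + exact self-similarity about the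
  origin + `V ∈ C²` + `HasCompactSupport (curl V)` ⇒ `u = 0` a.e.;
* `Shifted.selfSimilar_ae_eq_zero_of_compactCurlC2_profile` — the same about any `(T, x₀)`, `T ≥ 0` (`0 < ρ ≤ ½`).

WHAT THIS IS NOT: not NS, not E, not rung C1 — a classical sub-stratum (profiles of any growth whose vorticity is confined to a
ball) `--supports` stmt-19832; the weak class and rotational-at-infinity profiles remain OPEN. [folklore; ChaeShvydkoy2013 §4 Thm 4.1]
-/

noncomputable section

-- flat `Theorems/<Route><Decl>…` files of one crux share the namespace of the crux (tree convention: `Summit.<S>.<S>.…`)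
set_option linter.dupNamespace false

open MeasureTheory Set Filter Topology Metric Function InnerProductSpace TopologicalSpace
open scoped RealInnerProductSpace NNReal ENNReal ContDiff

namespace Summit.NavierStokesRegularity.NavierStokesRegularity.Theorems.PowerGaugeEulerLiouville

open Literature.Analysis Literature.Analysis.FunctionSpaces Literature.Analysis.FluidPDE

/-- **COMPACTLY SUPPORTED VORTICITY, CENTRED, MEMBER LEVEL** (`0 < ρ < 1`).  Crux hypotheses verbatim + exact self-similarity about
the origin with profile `(V, P)`: if `V ∈ C²` and `curl V` has compact support, then `u = 0` a.e. on `(−∞,0) × ℝ³` — CIV (3.3) for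
some `C¹` pressure is derived (`P ∈ L¹_loc` from the `D`-gauge), `curl V ≡ 0` by the Eulerian `p → 0` identity
(`IsSelfSimilarEulerProfile.curl_eq_zero_of_hasCompactSupport`), and the irrotational stratum
`Loc.selfSimilar_ae_eq_zero_of_irrotationalC2_profile` concludes.  No growth hypothesis on `V`. [cite: ChaeShvydkoy2013, §4 Thm. 4.1 (proof)] -/
theorem Loc.selfSimilar_ae_eq_zero_of_compactCurlC2_profile {ρ : ℝ} (hρ : 0 < ρ) (hρ1 : ρ < 1)
    {u : ℝ → EuclideanSpace ℝ (Fin 3) → EuclideanSpace ℝ (Fin 3)} {p : ℝ → EuclideanSpace ℝ (Fin 3) → ℝ}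
    {H : ℝ → EuclideanSpace ℝ (Fin 3) → EuclideanSpace ℝ (Fin 3) →L[ℝ] EuclideanSpace ℝ (Fin 3)} {c : ℝ≥0}
    (hsw : IsSuitableWeakSolutionOn (slab (EuclideanSpace ℝ (Fin 3)) (Iio 0) isOpen_Iio) 0 0 u p)
    (hgauge : ∀ a : ℝ, 0 < a →
      ENNReal.ofReal (a ^ (2 * ρ)) * cknA a (0 : ℝ × EuclideanSpace ℝ (Fin 3)) u +
          ENNReal.ofReal (a ^ ρ) * cknE a (0 : ℝ × EuclideanSpace ℝ (Fin 3)) H +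
        ENNReal.ofReal (a ^ (2 * ρ)) * cknD a (0 : ℝ × EuclideanSpace ℝ (Fin 3)) p ≤ (c : ℝ≥0∞))
    {V : EuclideanSpace ℝ (Fin 3) → EuclideanSpace ℝ (Fin 3)} {P : EuclideanSpace ℝ (Fin 3) → ℝ}
    (hu : ∀ τ : ℝ, τ < 0 → u τ = selfSimilarCollapse (1 / (2 + ρ)) 0 V τ)
    (hp : ∀ τ : ℝ, τ < 0 → p τ = selfSimilarCollapsePressure (1 / (2 + ρ)) 0 P τ)
    (hV : ContDiff ℝ 2 V) (hΩc : HasCompactSupport (curl V)) :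
    uncurry u =ᵐ[volume.restrict (Iio (0 : ℝ) ×ˢ (univ : Set (EuclideanSpace ℝ (Fin 3))))] 0 := by
  have h2ρ : (0 : ℝ) < 2 + ρ := by linarith
  have hγ : (0 : ℝ) < 1 / (2 + ρ) := one_div_pos.2 h2ρ
  have hA : ∀ a : ℝ, 0 < a → ENNReal.ofReal (a ^ (2 * ρ)) *
      cknA a (0 : ℝ × EuclideanSpace ℝ (Fin 3)) u ≤ (c : ℝ≥0∞) :=
    fun a ha => le_trans (le_trans le_self_add le_self_add) (hgauge a ha)
  have hD : ∀ a : ℝ, 0 < a → ENNReal.ofReal (a ^ (2 * ρ)) *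
      cknD a (0 : ℝ × EuclideanSpace ℝ (Fin 3)) p ≤ (c : ℝ≥0∞) :=
    fun a ha => le_trans le_add_self (hgauge a ha)
  -- `P ∈ L¹_loc` from the `D`-gauge and CIV (3.3) classically
  have hpm : AEStronglyMeasurable (uncurry p)
      (volume.restrict (Iio (0 : ℝ) ×ˢ (univ : Set (EuclideanSpace ℝ (Fin 3))))) := by
    have := hsw.distributional.2.2.1.aestronglyMeasurable
    simpa [slab] using this
  have hPm := aestronglyMeasurable_pressureProfile hpm hp
  have hDprof := profile_pressure_weight_of_gaugeD hρ hρ1 hpm hp hD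
  have hP1 : LocallyIntegrable P volume :=
    EnergySaturation.locallyIntegrable_pressure_of_weight hρ1 hPm
      (ENNReal.mul_ne_top ENNReal.ofReal_ne_top ENNReal.coe_ne_top) hDprof
  obtain ⟨P', hprof⟩ := WeakToClassical.exists_isSelfSimilarEulerProfile_of_contDiff hsw.distributional hu hp hV hP1
  -- irrotational by the Eulerian `p → 0` identity
  have hcurl0 : curl V = 0 := hprof.curl_eq_zero_of_hasCompactSupport hγ hΩc
  exact Loc.selfSimilar_ae_eq_zero_of_irrotationalC2_profile hρ hsw.distributional hA hu hV fun x => congrFun hcurl0 x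

namespace Shifted

/-- **COMPACTLY SUPPORTED VORTICITY, ANY BLOW-UP POINT, MEMBER LEVEL** (`0 < ρ ≤ ½`).  A distributional Euler pair on `(−∞,0) × ℝ³` with
the `A`-gauge at the origin, exactly self-similar about `(T, x₀)`, `T ≥ 0`, whose velocity profile is `C²` with compactly supported
vorticity, vanishes a.e.: CIV (3.3) on the origin-centred extension (`P ∈ L¹_loc` from the slab), `curl V ≡ 0` by
`IsSelfSimilarEulerProfile.curl_eq_zero_of_hasCompactSupport`, and `Shifted.selfSimilar_ae_eq_zero_of_irrotationalC2_profile`.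
[cite: ChaeShvydkoy2013, §4 Thm. 4.1 (proof)] -/
theorem selfSimilar_ae_eq_zero_of_compactCurlC2_profile {ρ : ℝ} (hρ : 0 < ρ) (hρh : ρ ≤ 1 / 2) {T : ℝ} (hT : 0 ≤ T)
    (x₀ : EuclideanSpace ℝ (Fin 3))
    {u : ℝ → EuclideanSpace ℝ (Fin 3) → EuclideanSpace ℝ (Fin 3)} {p : ℝ → EuclideanSpace ℝ (Fin 3) → ℝ} {c : ℝ≥0}
    (hsol : IsDistributionalNSSolutionOn (slab (EuclideanSpace ℝ (Fin 3)) (Iio 0) isOpen_Iio) 0 0 u p)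
    (hA : ∀ a : ℝ, 0 < a → ENNReal.ofReal (a ^ (2 * ρ)) *
      cknA a (0 : ℝ × EuclideanSpace ℝ (Fin 3)) u ≤ (c : ℝ≥0∞))
    {V : EuclideanSpace ℝ (Fin 3) → EuclideanSpace ℝ (Fin 3)} {P : EuclideanSpace ℝ (Fin 3) → ℝ}
    (hu : ∀ τ : ℝ, τ < 0 → u τ = fun x => selfSimilarCollapse (1 / (2 + ρ)) T V τ (x - x₀))
    (hp : ∀ τ : ℝ, τ < 0 → p τ = fun x => selfSimilarCollapsePressure (1 / (2 + ρ)) T P τ (x - x₀))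
    (hV : ContDiff ℝ 2 V) (hΩc : HasCompactSupport (curl V)) :
    uncurry u =ᵐ[volume.restrict (Iio (0 : ℝ) ×ˢ (univ : Set (EuclideanSpace ℝ (Fin 3))))] 0 := by
  have h2ρ : (0 : ℝ) < 2 + ρ := by linarith
  have hγ : (0 : ℝ) < 1 / (2 + ρ) := one_div_pos.2 h2ρ
  have hγ2 : 1 / (2 + ρ) < 1 / 2 := one_div_lt_one_div_of_lt two_pos (by linarith)
  -- the extension, `P ∈ L¹_loc`, CIV (3.3) classically
  have hext := isDistributional_selfSimilarCollapse_of_shifted hT x₀ hsol hu hp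
  have hpm : AEStronglyMeasurable (uncurry (selfSimilarCollapsePressure (1 / (2 + ρ)) 0 P))
      (volume.restrict (Iio (0 : ℝ) ×ˢ (univ : Set (EuclideanSpace ℝ (Fin 3))))) := by
    have := hext.2.2.1.aestronglyMeasurable
    simpa [slab] using this
  have hPm : AEStronglyMeasurable P volume :=
    aestronglyMeasurable_pressureProfile (p := selfSimilarCollapsePressure (1 / (2 + ρ)) 0 P) hpm fun _ _ => rfl
  have hP1 : LocallyIntegrable P volume :=
    locallyIntegrable_pressureProfile_of_slab hγ.le (by linarith) hPm hext.2.2.1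
  obtain ⟨P', hprof⟩ := WeakToClassical.exists_isSelfSimilarEulerProfile_of_contDiff hext
    (fun _ _ => rfl) (fun _ _ => rfl) hV hP1
  have hcurl0 : curl V = 0 := hprof.curl_eq_zero_of_hasCompactSupport hγ hΩc
  exact selfSimilar_ae_eq_zero_of_irrotationalC2_profile hρ hρh hT x₀ hsol hA hu hp hV fun x => congrFun hcurl0 x

end Shifted

end Summit.NavierStokesRegularity.NavierStokesRegularity.Theorems.PowerGaugeEulerLiouville

end
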